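/-
COR-CM (cell pub-hodgecm2, stage 2 of the Hodge ladder) — count-neutral KERNEL COMBINATORICS «the abelian slices are exact»
(seat prover-pub-hodgecm2-b23-g39-0, binder prover b23, gen 39; claim ABELIAN-DATUM D4, HOME/INBOX.md l.9517).  Theorems only: the
block/orbit dictionary under a datum, then this seat's slice existence (gens 36/37) against seat b09's coinvariant floors
(`CorCM/FaceCoinvariantOddHalf.lean` X, `CorCM/FaceCoinvariantComplement.lean` XIV) BY NAME; no geometry, no named fact, nothing asserted;
`Interfaces.lean` (C1), every E term, B01 and `Transposition/*` are untouched.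
HONEST FRAMING (COORDINATOR RULING — HODGE FRAMING CORRECTION, 2026-08-21T11:55:35Z): `HC_CM` is NOT proved, here or anywhere in the
tree; this file counts faces and produces no period.
T5: n/a-class — no HC-level conclusion; binders are the datum / presentation data of D1–D2; checker: self (prover-pub-hodgecm2-b23-g39-0),
2026-08-22.
-/
import Summits.HodgeConjecture.CorCM.FaceAbelianSlices
import Summits.HodgeConjecture.CorCM.FaceCoinvariantOddHalf
import Summits.HodgeConjecture.CorCM.FaceCoinvariantComplement
import HarnessLib

/-!
# The abelian slices are exact: `β(F) = #OrbitsA A + 1`, and the least number of generating faces is `β − 1` (odd) / `β − 2` (even)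

For a Galois CM field `F` with a dictionary datum `θ : GalT F ≃ ℤ/2 × A` (multiplicative-to-additive, `θ conjT = (1,0)`; by D1 it exists
iff `GalT F` is commutative and complex conjugation is not a square):

* §1 **`card_block_eq_card_orbitsA_add_one`**: the blocks of abstract CM types of `GalT F` (seat b09's `Block conjT` ↔ the simple CM
  isogeny classes split by `F`) correspond to the orbits of `ℤ/2 × A` on ALL labels `Ty A = (A → ℤ/2)` (gen 36's `typeMap` intertwines
  base change `rt` with b09's twist `tw`: `typeMap_rt`); the constant labels form ONE orbit (the CM elliptic curve `E` of the imaginary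
  quadratic subfield), the others are b17's `OrbitsA A`; hence **`β(F) = #OrbitsA A + 1`**.
* §2 **`exists_cpl_of_datum`**: the datum yields a complement of `conjT` in `GalT F` (the kernel of the first coordinate), the hypothesis
  of b09's XIV.
* §3 **EXACTNESS.**  `isLeast_card_faces_hgen_of_datum_odd`: `|A|` odd `≥ 3` ⟹ the least size of a face set `𝒮` with the INT2-GEN binder
  `hgen(𝒮, σ₀)` is EXACTLY `#OrbitsA A = β(F) − 1` (existence: gen 36's transport of b09's family; floor: b09 X
  `FaceCoinvariant.card_block_le_card_add_one_of_hgen_of_odd`).  `isLeast_card_faces_hgen_of_datum_even`: `|A|` even `≥ 4` ⟹ EXACTLY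
  `#OrbitsA A − 1 = β(F) − 2` (existence: gen 37's canonical squares; floor: b09 XIV `FaceCoinvariant.card_block_le_card_add_two_of_hgen_of_cpl`
  with §2's complement).  Datum-free wrappers (D1/D2): `isLeast_card_faces_hgen_of_presentation_{odd,even}` (commutative `Aut(F)`, non-square
  conjugation, presentation) and `isLeast_card_faces_hgen_cyclotomic_of_unitTable_{odd,even}` (`ℚ(ζ_N)`, all hypotheses decidable on
  `(ℤ/N)ˣ`).  With the numerals of gen 37 (`card_orbitsA_zmod_four = 3`, …) the named composite cyclotomic fields get their exact counts in
  the sequel `CorCM/FaceCyclotomicCompositeExact.lean` (`ℚ(ζ₁₅)`: exactly `2`, …).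

`HC_CM` is NOT proved; no period is produced.

References: [cite: Pohlmann1968, Thm. 1]; [cite: Milne1999LefschetzClasses, Thm. 3.2, Prop. 2.1]; [cite: Shimura1998, §8.1 (p. 62)];
[cite: Washington1997, Thm. 2.5].
-/

noncomputable section

open NumberField NumberField.ComplexEmbedding

namespace Summit.HodgeConjecture.CorCM.FaceAbelian

open Literature.AlgebraicGeometry.Motives (CMType)
open Summit.HodgeConjecture.CorCM.Prior.AllgGroup.RfwfAllgGroup
open Summit.HodgeConjecture.CorCM.Census.BlockParity
open Summit.HodgeConjecture.CorCM.Census.Coinvariant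
open Summit.HodgeConjecture.CorCM.Census.OddSliceFacesModel (Ty tw)
open Summit.HodgeConjecture.CorCM.Census.OddSliceFacesDescent (squares squares_places)
open Summit.HodgeConjecture.CorCM.Census.OddSliceFacesGenerate (family family_places)
open Summit.HodgeConjecture.CorCM.Census.OddSliceFacesCount (family_card)
open Summit.HodgeConjecture.CorCM.Census.EvenSliceFacesGenerate (hodge_le_pairs_sup_span_squares_of_even card_squares_add_one)
open Summit.HodgeConjecture.CorCM.Census.OddDegreeParityLaw (OrbitsA Nonconst vadd_val)
open Summit.HodgeConjecture.CorCM.FaceCensus.OddSlice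

variable {F : Type} [Field F] [NumberField F]
variable {A : Type} [AddCommGroup A] [Fintype A] [DecidableEq A]

/-! ## §1 Blocks ↔ orbits of labels: `β(F) = #OrbitsA A + 1` -/

omit [Fintype A] [DecidableEq A] in
/-- **Base change is the twist**: `typeMap θ (Ψ·Q) = tw (θ Q) (typeMap θ Ψ)` (gen 36's `typeMap_pullType_baseChange` read through b09's
`pullType_pushType_eq_rt`). [folklore] -/
theorem typeMap_rt [IsGalois ℚ F] (θ : GalT F ≃ ZMod 2 × A) (hθ : ∀ P Q : GalT F, θ (P * Q) = θ P + θ Q) (hc : θ conjT = (1, 0))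
    (Q : GalT F) (Ψ : CMF (GalT F) conjT) : typeMap θ (rt conjT Q Ψ) = tw A (θ Q) (typeMap θ Ψ) := by
  obtain ⟨σ₀⟩ : Nonempty (F →+* ℂ) := by
    have h : 0 < Fintype.card (F →+* ℂ) := by rw [Embeddings.card]; exact Module.finrank_pos
    exact Fintype.card_pos_iff.mp h
  have h1 : pullType (pushType σ₀ Ψ) σ₀ = Ψ := by
    have h := FaceParity.pullType_pushType_eq_rt σ₀ 1 Ψ
    rwa [GalT.one_apply, rt_one] at h
  rw [← FaceParity.pullType_pushType_eq_rt σ₀ Q Ψ, typeMap_pullType_baseChange θ hθ hc (pushType σ₀ Ψ) σ₀ Q, h1]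

omit [DecidableEq A] in
/-- **`β(F) = #OrbitsA A + 1`**: under a datum the blocks of abstract CM types of `GalT F` are the orbits of `ℤ/2 × A` on the labels
`A → ℤ/2`; the constant labels form one orbit (the CM elliptic curve of the imaginary quadratic subfield), the nonconstant ones are counted
by `OrbitsA A`. [cite: Milne1999LefschetzClasses, Prop. 2.1] -/
theorem card_block_eq_card_orbitsA_add_one [IsGalois ℚ F] (θ : GalT F ≃ ZMod 2 × A) (hθ : ∀ P Q : GalT F, θ (P * Q) = θ P + θ Q)
    (hc : θ conjT = (1, 0)) : Fintype.card (Block (conjT : GalT F)) = Fintype.card (OrbitsA A) + 1 := by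
  classical
  -- the label orbit map on types
  let cst : Ty A → Prop := fun φ => ∀ y, φ y = φ 0
  have hcst_tw : ∀ (g : ZMod 2 × A) (φ : Ty A), cst (tw A g φ) ↔ cst φ := by
    intro g φ
    constructor
    · intro h y
      have h1 := h (y - g.2)
      have h2 := h (0 - g.2)
      simp only [tw, sub_add_cancel, zero_add] at h1 h2
      have e1 : φ y = φ g.2 := add_right_cancel h1
      have e2 : φ 0 = φ g.2 := add_right_cancel h2
      rw [e1, e2]
    · intro h y
      simp only [tw]
      rw [h (y + g.2), h (0 + g.2)]
  let gmap : CMF (GalT F) conjT → Option (OrbitsA A) := fun Ψ =>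
    if h : cst (typeMap θ Ψ) then none else some (Quotient.mk'' ⟨typeMap θ Ψ, h⟩)
  -- twists of a nonconstant label lie in its orbit
  have horb : ∀ (g : ZMod 2 × A) (φ : Ty A) (hφ : ¬ cst φ) (hφ' : ¬ cst (tw A g φ)),
      (Quotient.mk'' ⟨tw A g φ, hφ'⟩ : OrbitsA A) = Quotient.mk'' ⟨φ, hφ⟩ := by
    intro g φ hφ hφ'
    apply Quotient.sound
    refine ⟨(g.1, -g.2), Subtype.ext (funext fun y => ?_)⟩
    rw [vadd_val]
    simp only [tw, sub_neg_eq_add]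
  -- same block ↔ same image
  have hiff : ∀ Ψ Ψ' : CMF (GalT F) conjT, (∃ Q : GalT F, rt conjT Q Ψ = Ψ') ↔ gmap Ψ = gmap Ψ' := by
    intro Ψ Ψ'
    constructor
    · rintro ⟨Q, rfl⟩
      by_cases h : cst (typeMap θ Ψ)
      · have h' : cst (typeMap θ (rt conjT Q Ψ)) := by rw [typeMap_rt θ hθ hc]; exact (hcst_tw _ _).mpr h
        simp only [gmap, dif_pos h, dif_pos h']
      · have h' : ¬ cst (typeMap θ (rt conjT Q Ψ)) := by rw [typeMap_rt θ hθ hc]; exact fun h'' => h ((hcst_tw _ _).mp h'')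
        simp only [gmap, dif_neg h, dif_neg h', Option.some.injEq]
        have h'' : ¬ cst (tw A (θ Q) (typeMap θ Ψ)) := fun h'' => h ((hcst_tw _ _).mp h'')
        have e : (Quotient.mk'' ⟨typeMap θ (rt conjT Q Ψ), h'⟩ : OrbitsA A) = Quotient.mk'' ⟨tw A (θ Q) (typeMap θ Ψ), h''⟩ := by
          congr 1; exact Subtype.ext (typeMap_rt θ hθ hc Q Ψ)
        rw [e, horb]
    · intro hg
      by_cases h : cst (typeMap θ Ψ)
      · by_cases h' : cst (typeMap θ Ψ')
        · -- both constant: they differ by the translate `θ⁻¹ (v' − v, 0)`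
          refine ⟨θ.symm (typeMap θ Ψ' 0 - typeMap θ Ψ 0, 0), typeMap_injective θ hθ hc ?_⟩
          rw [typeMap_rt θ hθ hc, θ.apply_symm_apply]
          funext y
          simp only [tw, add_zero]
          rw [h y, h' y]; abel
        · simp only [gmap, dif_pos h, dif_neg h'] at hg
          cases hg
      · by_cases h' : cst (typeMap θ Ψ')
        · simp only [gmap, dif_neg h, dif_pos h'] at hg
          cases hg
        · simp only [gmap, dif_neg h, dif_neg h', Option.some.injEq] at hg
          obtain ⟨g, hg⟩ := Quotient.exact hg
          -- hg : g +ᵥ ⟨typeMap θ Ψ', _⟩ = ⟨typeMap θ Ψ, _⟩  (Ψ ∈ orbit of Ψ')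
          have hval : ∀ y, typeMap θ Ψ y = typeMap θ Ψ' (y - g.2) + g.1 := fun y => by
            have := congrArg (fun φ : Nonconst A => φ.1 y) hg
            simp only [vadd_val] at this
            exact this.symm
          refine ⟨θ.symm (g.1, g.2), typeMap_injective θ hθ hc ?_⟩
          rw [typeMap_rt θ hθ hc, θ.apply_symm_apply]
          funext y
          simp only [tw]
          rw [hval (y + g.2), add_sub_cancel_right]
          have h2 : ∀ u v : ZMod 2, v + u + u = v := by decide
          exact h2 _ _
  -- descend to blocks
  let f : Block (conjT : GalT F) → Option (OrbitsA A) :=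
    Quotient.lift (s := blockSetoid (conjT : GalT F)) gmap (fun Ψ Ψ' h => (hiff Ψ Ψ').mp h)
  have hf_inj : Function.Injective f := by
    intro x y hxy
    induction x using Quotient.ind
    induction y using Quotient.ind
    exact Quotient.sound ((hiff _ _).mpr hxy)
  have hf_surj : Function.Surjective f := by
    rintro (_ | q)
    · refine ⟨blk conjT (typeOf θ hθ hc fun _ => 0), ?_⟩
      have h : cst (typeMap θ (typeOf θ hθ hc fun _ => (0 : ZMod 2))) := by
        rw [typeMap_typeOf]; intro y; rfl
      show gmap _ = none
      simp only [gmap, dif_pos h]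
    · induction q using Quotient.inductionOn with
      | h φ =>
        refine ⟨blk conjT (typeOf θ hθ hc φ.1), ?_⟩
        have h : ¬ cst (typeMap θ (typeOf θ hθ hc φ.1)) := by rw [typeMap_typeOf]; exact φ.2
        show gmap _ = _
        simp only [gmap, dif_neg h, Option.some.injEq]
        congr 1
        exact Subtype.ext (typeMap_typeOf θ hθ hc φ.1)
  rw [← Fintype.card_option]
  exact Fintype.card_congr (Equiv.ofBijective f ⟨hf_inj, hf_surj⟩)

omit [AddCommGroup A] [DecidableEq A] in
/-- `[F:ℚ] = 2|A|` under a datum. [folklore] -/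
theorem finrank_eq_two_mul_card_of_datum [IsGalois ℚ F] (θ : GalT F ≃ ZMod 2 × A) :
    Module.finrank ℚ F = 2 * Fintype.card A := by
  rw [← FaceCensus.card_galT, Fintype.card_congr θ, Fintype.card_prod, ZMod.card]

/-! ## §2 The complement of `conjT` from a datum -/

omit [Fintype A] [DecidableEq A] in
/-- **A datum complements complex conjugation**: the Galois translates with first coordinate `0` form a subgroup `A'` with
`P ∈ A' ↔ conjT·P ∉ A'` (the hypothesis of seat b09's `FaceCoinvariantComplement`). [folklore] -/
theorem exists_cpl_of_datum (θ : GalT F ≃ ZMod 2 × A) (hθ : ∀ P Q : GalT F, θ (P * Q) = θ P + θ Q) (hc : θ conjT = (1, 0)) :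
    ∃ A' : Subgroup (GalT F), ∀ P : GalT F, P ∈ A' ↔ conjT * P ∉ A' := by
  let χ : GalT F →* Multiplicative (ZMod 2) :=
    { toFun := fun P => Multiplicative.ofAdd (θ P).1
      map_one' := by rw [theta_one θ hθ]; rfl
      map_mul' := fun P Q => by rw [hθ, Prod.fst_add, ofAdd_add] }
  refine ⟨χ.ker, fun P => ?_⟩
  rw [MonoidHom.mem_ker, MonoidHom.mem_ker]
  change Multiplicative.ofAdd (θ P).1 = 1 ↔ ¬ Multiplicative.ofAdd (θ (conjT * P)).1 = 1
  rw [hθ, hc, Prod.fst_add]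
  have key : ∀ u : ZMod 2, Multiplicative.ofAdd u = 1 ↔ ¬ Multiplicative.ofAdd (1 + u) = 1 := by decide
  exact key _

/-! ## §3 Exactness -/

/-- **ODD SLICE, EXACT (datum form).**  `|A|` odd `≥ 3`: the least size of a face set `𝒮` of `F` with `hgen(𝒮, σ₀)` is
`#OrbitsA A` (`= β(F) − 1`), for every base embedding `σ₀`. [cite: Pohlmann1968, Thm. 1] [cite: Milne1999LefschetzClasses, Thm. 3.2] -/
theorem isLeast_card_faces_hgen_of_datum_odd [IsCMField F] [IsGalois ℚ F] (hA : Odd (Fintype.card A)) (h3 : 3 ≤ Fintype.card A)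
    (θ : GalT F ≃ ZMod 2 × A) (hθ : ∀ P Q : GalT F, θ (P * Q) = θ P + θ Q) (hc : θ conjT = (1, 0)) (σ₀ : F →+* ℂ) :
    IsLeast {m : ℕ | ∃ 𝒮 : Finset (Face F), 𝒮.card = m ∧
      ∀ f : Face F, lefChar f.corner (fun _ => ({σ₀} : Finset (F →+* ℂ))) ∈ AddSubgroup.closure
        {a : Asym F | ∃ g ∈ (𝒮 : Set (Face F)), ∃ σ : F →+* ℂ, a = lefChar g.corner (fun _ => ({σ} : Finset (F →+* ℂ)))}}
      (Fintype.card (OrbitsA A)) := by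
  have hβ := card_block_eq_card_orbitsA_add_one θ hθ hc
  have hodd : Odd (Module.finrank ℚ F / 2) := by
    rw [finrank_eq_two_mul_card_of_datum θ, Nat.mul_div_cancel_left _ (by norm_num : 0 < 2)]; exact hA
  have floor : ∀ 𝒮 : Finset (Face F), (∀ f : Face F, lefChar f.corner (fun _ => ({σ₀} : Finset (F →+* ℂ))) ∈ AddSubgroup.closure
      {a : Asym F | ∃ g ∈ (𝒮 : Set (Face F)), ∃ σ : F →+* ℂ, a = lefChar g.corner (fun _ => ({σ} : Finset (F →+* ℂ)))}) →
      Fintype.card (OrbitsA A) ≤ 𝒮.card := fun 𝒮 hgen => by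
    have h := FaceCoinvariant.card_block_le_card_add_one_of_hgen_of_odd hodd 𝒮 σ₀ hgen
    omega
  constructor
  · obtain ⟨𝒮, hcard, hgen⟩ := exists_faces_hgen_of_hodge_le θ hθ hc (family A) (fun s hs => family_places A h3 hs)
      (hodge_le_pairs_sup_span_family hA h3) σ₀
    rw [family_card A h3] at hcard
    exact ⟨𝒮, le_antisymm hcard (floor 𝒮 hgen), hgen⟩
  · rintro m ⟨𝒮, rfl, hgen⟩
    exact floor 𝒮 hgen

/-- **… in the block currency: `#OrbitsA A = β(F) − 1`.** [folklore] -/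
theorem isLeast_card_faces_hgen_of_datum_odd' [IsCMField F] [IsGalois ℚ F] (hA : Odd (Fintype.card A)) (h3 : 3 ≤ Fintype.card A)
    (θ : GalT F ≃ ZMod 2 × A) (hθ : ∀ P Q : GalT F, θ (P * Q) = θ P + θ Q) (hc : θ conjT = (1, 0)) (σ₀ : F →+* ℂ) :
    IsLeast {m : ℕ | ∃ 𝒮 : Finset (Face F), 𝒮.card = m ∧
      ∀ f : Face F, lefChar f.corner (fun _ => ({σ₀} : Finset (F →+* ℂ))) ∈ AddSubgroup.closure
        {a : Asym F | ∃ g ∈ (𝒮 : Set (Face F)), ∃ σ : F →+* ℂ, a = lefChar g.corner (fun _ => ({σ} : Finset (F →+* ℂ)))}}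
      (Fintype.card (Block (conjT : GalT F)) - 1) := by
  rw [card_block_eq_card_orbitsA_add_one θ hθ hc, Nat.add_sub_cancel]
  exact isLeast_card_faces_hgen_of_datum_odd hA h3 θ hθ hc σ₀

/-- **EVEN SLICE, EXACT (datum form).**  `|A|` even `≥ 4`: the least size of a face set `𝒮` of `F` with `hgen(𝒮, σ₀)` is
`#OrbitsA A − 1` (`= β(F) − 2`), for every base embedding `σ₀`. [cite: Pohlmann1968, Thm. 1] [cite: Milne1999LefschetzClasses, Thm. 3.2] -/
theorem isLeast_card_faces_hgen_of_datum_even [IsCMField F] [IsGalois ℚ F] (hA : Even (Fintype.card A)) (h4 : 4 ≤ Fintype.card A)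
    (θ : GalT F ≃ ZMod 2 × A) (hθ : ∀ P Q : GalT F, θ (P * Q) = θ P + θ Q) (hc : θ conjT = (1, 0)) (σ₀ : F →+* ℂ) :
    IsLeast {m : ℕ | ∃ 𝒮 : Finset (Face F), 𝒮.card = m ∧
      ∀ f : Face F, lefChar f.corner (fun _ => ({σ₀} : Finset (F →+* ℂ))) ∈ AddSubgroup.closure
        {a : Asym F | ∃ g ∈ (𝒮 : Set (Face F)), ∃ σ : F →+* ℂ, a = lefChar g.corner (fun _ => ({σ} : Finset (F →+* ℂ)))}}
      (Fintype.card (OrbitsA A) - 1) := by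
  have hβ := card_block_eq_card_orbitsA_add_one θ hθ hc
  have heven : Even (Module.finrank ℚ F / 2) := by
    rw [finrank_eq_two_mul_card_of_datum θ, Nat.mul_div_cancel_left _ (by norm_num : 0 < 2)]; exact hA
  obtain ⟨A', hA'⟩ := exists_cpl_of_datum θ hθ hc
  have floor : ∀ 𝒮 : Finset (Face F), (∀ f : Face F, lefChar f.corner (fun _ => ({σ₀} : Finset (F →+* ℂ))) ∈ AddSubgroup.closure
      {a : Asym F | ∃ g ∈ (𝒮 : Set (Face F)), ∃ σ : F →+* ℂ, a = lefChar g.corner (fun _ => ({σ} : Finset (F →+* ℂ)))}) →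
      Fintype.card (OrbitsA A) - 1 ≤ 𝒮.card := fun 𝒮 hgen => by
    have h := (FaceCoinvariant.card_block_le_card_add_two_of_hgen_of_cpl hA' heven 𝒮 σ₀ hgen).1
    omega
  have hsq := card_squares_add_one A (by omega : 1 < Fintype.card A)
  constructor
  · obtain ⟨𝒮, hcard, hgen⟩ := exists_faces_hgen_of_hodge_le θ hθ hc (squares A) (fun s hs => squares_places A hs)
      (hodge_le_pairs_sup_span_squares_of_even A hA) σ₀
    exact ⟨𝒮, by have := floor 𝒮 hgen; omega, hgen⟩
  · rintro m ⟨𝒮, rfl, hgen⟩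
    exact floor 𝒮 hgen

/-- **… in the block currency: `#OrbitsA A − 1 = β(F) − 2`.** [folklore] -/
theorem isLeast_card_faces_hgen_of_datum_even' [IsCMField F] [IsGalois ℚ F] (hA : Even (Fintype.card A)) (h4 : 4 ≤ Fintype.card A)
    (θ : GalT F ≃ ZMod 2 × A) (hθ : ∀ P Q : GalT F, θ (P * Q) = θ P + θ Q) (hc : θ conjT = (1, 0)) (σ₀ : F →+* ℂ) :
    IsLeast {m : ℕ | ∃ 𝒮 : Finset (Face F), 𝒮.card = m ∧
      ∀ f : Face F, lefChar f.corner (fun _ => ({σ₀} : Finset (F →+* ℂ))) ∈ AddSubgroup.closure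
        {a : Asym F | ∃ g ∈ (𝒮 : Set (Face F)), ∃ σ : F →+* ℂ, a = lefChar g.corner (fun _ => ({σ} : Finset (F →+* ℂ)))}}
      (Fintype.card (Block (conjT : GalT F)) - 2) := by
  rw [card_block_eq_card_orbitsA_add_one θ hθ hc]
  have h : Fintype.card (OrbitsA A) + 1 - 2 = Fintype.card (OrbitsA A) - 1 := by omega
  rw [h]
  exact isLeast_card_faces_hgen_of_datum_even hA h4 θ hθ hc σ₀

/-! ## §4 Datum-free forms -/

section DatumFree

omit [DecidableEq A]

/-- **ODD SLICE, EXACT — presentation form** (commutative `Aut(F)`; `c` the conjugation at `σ₀`, not a square — automatic here by D1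
`not_isSquare_conjAut_of_odd`, kept as a hypothesis for uniformity; `π : Aut(F) ↠ A` presenting `Aut(F)/⟨c⟩`, `|A|` odd `≥ 3`):
least `|𝒮|` with `hgen(𝒮, σ₀)` is `#OrbitsA A`. [folklore] -/
theorem isLeast_card_faces_hgen_of_presentation_odd [IsCMField F] [IsGalois ℚ F] (hcomm : ∀ g h : F ≃ₐ[ℚ] F, g * h = h * g)
    (σ₀ : F →+* ℂ) {c : F ≃ₐ[ℚ] F} (hcσ : σ₀.comp (c : F →+* F) = conjugate σ₀) (hns : ¬ IsSquare c)
    (π : (F ≃ₐ[ℚ] F) → A) (hπ : ∀ g h, π (g * h) = π g + π h) (hπc : π c = 0) (hker : ∀ g, π g = 0 → g = 1 ∨ g = c)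
    (hsurj : Function.Surjective π) (hA : Odd (Fintype.card A)) (h3 : 3 ≤ Fintype.card A) :
    IsLeast {m : ℕ | ∃ 𝒮 : Finset (Face F), 𝒮.card = m ∧
      ∀ f : Face F, lefChar f.corner (fun _ => ({σ₀} : Finset (F →+* ℂ))) ∈ AddSubgroup.closure
        {a : Asym F | ∃ g ∈ (𝒮 : Set (Face F)), ∃ σ : F →+* ℂ, a = lefChar g.corner (fun _ => ({σ} : Finset (F →+* ℂ)))}}
      (Fintype.card (OrbitsA A)) := by
  classical
  obtain ⟨ε, hε, hεc⟩ := exists_autDatum_of_not_isSquare hcomm hns π hπ hπc hker hsurj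
  obtain ⟨hθ, hc⟩ := autDatum σ₀ ε hε hcσ hεc
  exact isLeast_card_faces_hgen_of_datum_odd hA h3 _ hθ hc σ₀

/-- **EVEN SLICE, EXACT — presentation form** (`|A|` even `≥ 4`): least `|𝒮|` with `hgen(𝒮, σ₀)` is `#OrbitsA A − 1`. [folklore] -/
theorem isLeast_card_faces_hgen_of_presentation_even [IsCMField F] [IsGalois ℚ F] (hcomm : ∀ g h : F ≃ₐ[ℚ] F, g * h = h * g)
    (σ₀ : F →+* ℂ) {c : F ≃ₐ[ℚ] F} (hcσ : σ₀.comp (c : F →+* F) = conjugate σ₀) (hns : ¬ IsSquare c)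
    (π : (F ≃ₐ[ℚ] F) → A) (hπ : ∀ g h, π (g * h) = π g + π h) (hπc : π c = 0) (hker : ∀ g, π g = 0 → g = 1 ∨ g = c)
    (hsurj : Function.Surjective π) (hA : Even (Fintype.card A)) (h4 : 4 ≤ Fintype.card A) :
    IsLeast {m : ℕ | ∃ 𝒮 : Finset (Face F), 𝒮.card = m ∧
      ∀ f : Face F, lefChar f.corner (fun _ => ({σ₀} : Finset (F →+* ℂ))) ∈ AddSubgroup.closure
        {a : Asym F | ∃ g ∈ (𝒮 : Set (Face F)), ∃ σ : F →+* ℂ, a = lefChar g.corner (fun _ => ({σ} : Finset (F →+* ℂ)))}}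
      (Fintype.card (OrbitsA A) - 1) := by
  classical
  obtain ⟨ε, hε, hεc⟩ := exists_autDatum_of_not_isSquare hcomm hns π hπ hπc hker hsurj
  obtain ⟨hθ, hc⟩ := autDatum σ₀ ε hε hcσ hεc
  exact isLeast_card_faces_hgen_of_datum_even hA h4 _ hθ hc σ₀

variable {N : ℕ} [NeZero N]

/-- **ODD SLICE OF `ℚ(ζ_N)`, EXACT — unit-table form** (all hypotheses decidable on `(ℤ/N)ˣ`): least `|𝒮|` with `hgen(𝒮, σ₀)` is
`#OrbitsA A`. [cite: Washington1997, Thm. 2.5] -/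
theorem isLeast_card_faces_hgen_cyclotomic_of_unitTable_odd [IsCMField F] [IsCyclotomicExtension {N} ℚ F]
    (hN : ∀ r : (ZMod N)ˣ, r * r ≠ -1) (t : (ZMod N)ˣ → A) (ht : ∀ u v, t (u * v) = t u + t v) (ht1 : t (-1) = 0)
    (htker : ∀ u, t u = 0 → u = 1 ∨ u = -1) (htsurj : Function.Surjective t) (hA : Odd (Fintype.card A)) (h3 : 3 ≤ Fintype.card A)
    (σ₀ : F →+* ℂ) :
    IsLeast {m : ℕ | ∃ 𝒮 : Finset (Face F), 𝒮.card = m ∧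
      ∀ f : Face F, lefChar f.corner (fun _ => ({σ₀} : Finset (F →+* ℂ))) ∈ AddSubgroup.closure
        {a : Asym F | ∃ g ∈ (𝒮 : Set (Face F)), ∃ σ : F →+* ℂ, a = lefChar g.corner (fun _ => ({σ} : Finset (F →+* ℂ)))}}
      (Fintype.card (OrbitsA A)) := by
  classical
  haveI := IsCyclotomicExtension.isGalois {N} ℚ F
  obtain ⟨c, ε, hcσ, hε, hεc⟩ := exists_autDatum_cyclotomic_of_unitTable F hN t ht ht1 htker htsurj σ₀
  obtain ⟨hθ, hc⟩ := autDatum σ₀ ε hε hcσ hεc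
  exact isLeast_card_faces_hgen_of_datum_odd hA h3 _ hθ hc σ₀

/-- **EVEN SLICE OF `ℚ(ζ_N)`, EXACT — unit-table form**: least `|𝒮|` with `hgen(𝒮, σ₀)` is `#OrbitsA A − 1`. [cite: Washington1997, Thm. 2.5] -/
theorem isLeast_card_faces_hgen_cyclotomic_of_unitTable_even [IsCMField F] [IsCyclotomicExtension {N} ℚ F]
    (hN : ∀ r : (ZMod N)ˣ, r * r ≠ -1) (t : (ZMod N)ˣ → A) (ht : ∀ u v, t (u * v) = t u + t v) (ht1 : t (-1) = 0)
    (htker : ∀ u, t u = 0 → u = 1 ∨ u = -1) (htsurj : Function.Surjective t) (hA : Even (Fintype.card A)) (h4 : 4 ≤ Fintype.card A)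
    (σ₀ : F →+* ℂ) :
    IsLeast {m : ℕ | ∃ 𝒮 : Finset (Face F), 𝒮.card = m ∧
      ∀ f : Face F, lefChar f.corner (fun _ => ({σ₀} : Finset (F →+* ℂ))) ∈ AddSubgroup.closure
        {a : Asym F | ∃ g ∈ (𝒮 : Set (Face F)), ∃ σ : F →+* ℂ, a = lefChar g.corner (fun _ => ({σ} : Finset (F →+* ℂ)))}}
      (Fintype.card (OrbitsA A) - 1) := by
  classical
  haveI := IsCyclotomicExtension.isGalois {N} ℚ F
  obtain ⟨c, ε, hcσ, hε, hεc⟩ := exists_autDatum_cyclotomic_of_unitTable F hN t ht ht1 htker htsurj σ₀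
  obtain ⟨hθ, hc⟩ := autDatum σ₀ ε hε hcσ hεc
  exact isLeast_card_faces_hgen_of_datum_even hA h4 _ hθ hc σ₀

end DatumFree

end Summit.HodgeConjecture.CorCM.FaceAbelian

end
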